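import Mathlib
import Summits.PneNP.PneNP.Theses.ConvexRankGates
import Literature.Computability.Complexity.ExtMonotoneGates
import Literature.Computability.Complexity.ExtMonotoneGRankSupport
import Literature.Computability.AlgebraicComplexity.DeterminantalComplexity
import Literature.Computability.AlgebraicComplexity.PermanentVsDeterminant
import Literature.Computability.AlgebraicComplexity.ValiantCriterion

/-!
# Sketch — crux `Capture` (stmt-PneNP-2659), round 2, ideator 4: the PERMANENT BRIDGE

First lemmas (statements only; they must ELABORATE, not be proved here) of the idea card
`permanent-shadow-bridge`:

* §1 `upsetGF f` — the up-set generating function `∑_{T : f T = 1} X^T` of a Boolean function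
  (= `ValiantCriterion.circuitSum Q` when `Q` computes `f`).
* §2 `GFShadowOneGate` — a determinantal representation of size `d` of `upsetGF f` over ANY
  field is ONE GRANK gate of dimension `d` computing the monotone `f` (support shadow: the
  minimal monomial supports of `upsetGF f` are exactly the minterms of `f`).
* §3 `AdmissibleWeightingOneGate` — the flexible form: any weighting `g` vanishing off `f⁻¹(1)`
  and non-vanishing on the minterms, whose multilinear extension has `dc ≤ d`, gives the gate.
* §4 `CaptureOfSmallHC` / `CaptureOfSmallPermanent` — the BRIDGE: if over SOME field the
  Hamiltonian-cycle family (resp., in characteristic 0, the permanent family) has polynomially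
  bounded determinantal complexity, then `Capture` holds (with size-ONE simulating circuits).
* §5 `NotCaptureImpValiant`, `LinAlgGateBlindImpValiant` — the contrapositives: refuting the
  crux, or proving the route's crux #4, proves Valiant's hypothesis over EVERY field.
* §6 `MonotoneABPOneGate` — the unconditional fragment: a monotone algebraic branching program
  (switching DAG with variable labels, positive path counts in characteristic 0) is one GRANK gate.
-/

set_option linter.dupNamespace false

namespace Summit.PneNP.PneNP.Cruxes.Capture.Ideator4

open Literature.Computability.Complexity Literature.Computability.AlgebraicComplexity
open MvPolynomial
open Summit.PneNP.PneNP.Theses.ConvexRankGates (Capture LinAlgGateBlind)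

noncomputable section

/-! ## §1 The up-set generating function -/

/-- `upsetGF f = ∑_{T ∈ {0,1}ⁿ, f T = 1} ∏_{i : T i = 1} Xᵢ` over the field `F`. -/
def upsetGF (F : Type) [Field F] {n : ℕ} (f : (Fin n → Bool) → Bool) : MvPolynomial (Fin n) F :=
  ∑ T : Fin n → Bool, if f T then ∏ i : Fin n, (if T i then X i else 1) else 0

/-- The multilinear extension of a weighting `g : {0,1}ⁿ → F`:
`∑_T g(T) ∏ᵢ (Tᵢ Xᵢ + (1 - Tᵢ)(1 - Xᵢ))`. -/
def mlExt (F : Type) [Field F] {n : ℕ} (g : (Fin n → Bool) → F) : MvPolynomial (Fin n) F :=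
  ∑ T : Fin n → Bool, C (g T) * ∏ i : Fin n, (if T i then X i else (1 - X i))

/-- Minterms of a Boolean function. -/
def IsMinterm {n : ℕ} (f : (Fin n → Bool) → Bool) (T : Fin n → Bool) : Prop :=
  f T = true ∧ ∀ S : Fin n → Bool, S ≤ T → S ≠ T → f S = false

/-! ## §2 A determinantal representation of `upsetGF f` is one GRANK gate computing `f` -/

/-- FIRST LEMMA (provable now from `IsGRankGate.eq_true_iff_exists_support` /
`killVars_ne_zero_iff`): for MONOTONE `f`, if `upsetGF f = det A` with `A` a `d × d` matrix of
affine linear forms over a field `F`, then the gate `v ↦ [d ≤ rank (K₀ + ∑_{vᵢ=1} Xᵢ Kᵢ)]`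
(where `A = K₀ + ∑ Xᵢ Kᵢ`) computes `f`, so `f` has a size-ONE circuit over `GRANK_d`. -/
def GFShadowOneGate : Prop :=
  ∀ (F : Type) [Field F] (n d : ℕ) (f : (Fin n → Bool) → Bool), Monotone f →
    HasDetRepr (upsetGF F f) d →
      ∃ C : Circuit (Fin n), C.IsOver {g | IsGRankGate d g} ∧ C.size = 1 ∧ C.Computes f

/-! ## §3 Flexible form: admissible weightings -/

/-- ADMISSIBLE-WEIGHTING CRITERION: `g` vanishes where `f = 0`, is non-zero on every minterm of
`f`, and its multilinear extension has a `d × d` affine determinantal representation over `F`;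
then `f` (monotone) is one `GRANK_d` gate. (`g = f` itself, or `g = #witnesses` in
characteristic 0, or `g = det`-signed counts as in Edmonds/Tutte, are the instances in print.) -/
def AdmissibleWeightingOneGate : Prop :=
  ∀ (F : Type) [Field F] (n d : ℕ) (f : (Fin n → Bool) → Bool) (g : (Fin n → Bool) → F),
    Monotone f → (∀ T, f T = false → g T = 0) → (∀ T, IsMinterm f T → g T ≠ 0) →
    HasDetRepr (mlExt F g) d →
      ∃ C : Circuit (Fin n), C.IsOver {g | IsGRankGate d g} ∧ C.size = 1 ∧ C.Computes f

/-! ## §4 The bridge: small Hamiltonian cycles / small permanents ⇒ Capture -/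

/-- BRIDGE (Hamiltonian-cycle form, every characteristic): if over some field `F` the family
`HC_m` has polynomially bounded determinantal complexity (the negation of Valiant's hypothesis
over `F` in `dc` form; `HC` is `VNP`-complete over every field — in tree
`isVNPComplete_hcPoly_holds`), then `Capture` holds. Chain: `f` monotone with a `B₂`-circuit
`Q` of size `t` ⇒ `upsetGF f = circuitSum Q ∈ VNP` uniformly in `(n, t)`
(`isVNPFamily_circuitSum`, via a universal circuit) ⇒ p-projection of `HC_{poly(t+n)}` ⇒
`dc (upsetGF f) ≤ poly(t + n)` ⇒ one GRANK gate (§2). -/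
def CaptureOfSmallHC : Prop :=
  (∃ (F : Type) (_ : Field F),
      IsPBounded fun m =>
      Literature.Computability.AlgebraicComplexity.determinantalComplexity (hcPoly (Fin m) F)) → Capture

/-- BRIDGE (permanent form, characteristic 0): `¬ DcPerSuperpolynomial F` for some field of
characteristic zero implies `Capture` (permanent `VNP`-complete in characteristic `≠ 2`). -/
def CaptureOfSmallPermanent : Prop :=
  (∃ (F : Type) (_ : Field F) (_ : CharZero F), ¬ DcPerSuperpolynomial F) → Capture

/-! ## §5 Contrapositives: what a refutation of the crux, or a proof of crux #4, would prove -/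

/-- Refuting `Capture` proves Valiant's hypothesis (in `dc(HC)` form) over EVERY field. -/
def NotCaptureImpValiant : Prop :=
  ¬ Capture → ∀ (F : Type) [Field F],
    ¬ IsPBounded fun m =>
      Literature.Computability.AlgebraicComplexity.determinantalComplexity (hcPoly (Fin m) F)

/-- The route's crux #4 `LinAlgGateBlind` (no poly `{∧,∨}+PERM+GRANK` circuit for CLIQUE) already
implies Valiant's hypothesis over every field: the clique-COUNT weighting
`g(T) = #k-cliques ⊆ T` is admissible in every characteristic (`= 1` on minterms) and its
multilinear extension is in `VNP` (Valiant's criterion with a clique-checking circuit). -/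
def LinAlgGateBlindImpValiant : Prop :=
  LinAlgGateBlind → ∀ (F : Type) [Field F],
    ¬ IsPBounded fun m =>
      Literature.Computability.AlgebraicComplexity.determinantalComplexity (hcPoly (Fin m) F)

/-- In characteristic 0 the same with the permanent: `LinAlgGateBlind → DcPerSuperpolynomial ℂ`. -/
def LinAlgGateBlindImpDcPer : Prop :=
  LinAlgGateBlind → DcPerSuperpolynomial ℂ

/-! ## §6 Unconditional fragment: monotone algebraic branching programs are one GRANK gate -/

/-- A monotone switching DAG on `w` nodes: edges go from lower to higher index and carry either
no label (`none`, always usable) or an input variable (usable iff that input is `1`). -/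
structure MonSwitchDAG (n w : ℕ) where
  edge : Fin w → Fin w → Option (Option (Fin n))  -- `none` = no edge; `some none` = free edge; `some (some i)` = labelled `xᵢ`
  acyclic : ∀ u v, edge u v ≠ none → u < v
  src : Fin w
  snk : Fin w

namespace MonSwitchDAG

variable {n w : ℕ}

/-- An edge is usable under input `x`. -/
def usable (N : MonSwitchDAG n w) (x : Fin n → Bool) (u v : Fin w) : Prop :=
  ∃ l, N.edge u v = some l ∧ ∀ i, l = some i → x i = true

/-- The (monotone) function computed: the sink is reachable from the source along usable edges. -/
def accepts (N : MonSwitchDAG n w) (x : Fin n → Bool) : Bool := by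
  classical exact decide (Relation.ReflTransGen (N.usable x) N.src N.snk)

end MonSwitchDAG

/-- UNCONDITIONAL FRAGMENT (`mNL ⊆ GRANK¹`): the function of a monotone switching DAG on `w`
nodes is ONE GRANK gate of dimension `≤ w + 1` over `ℚ`. Proof plan: the path generating
polynomial `P_N = ∑_{src-snk paths} ∏ labels` has POSITIVE integer coefficients (no
cancellation in characteristic 0), so its inclusion-minimal monomial supports are exactly the
minterms of `N.accepts`; `P_N = ((I - A_X)⁻¹)_{src,snk} = ±` an affine `(w-1) × (w-1)` minor
of `I - A_X` (`A_X` nilpotent), i.e. `HasDetRepr P_N (w - 1)`; conclude by the support shadow. -/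
def MonotoneABPOneGate : Prop :=
  ∀ (n w : ℕ) (N : MonSwitchDAG n w),
    ∃ C : Circuit (Fin n), C.IsOver {g | IsGRankGate (w + 1) g} ∧ C.size = 1 ∧ C.Computes N.accepts

/-! ## §7 Sanity: `upsetGF` is literally `ValiantCriterion.circuitSum` when the circuit computes `f` -/

/-- Read-back (provable by `Finset.sum_congr`; stated): Valiant's criterion object is our
generating function. -/
def upsetGF_eq_circuitSum : Prop :=
  ∀ (F : Type) [Field F] (m : ℕ) (Q : Circuit (Fin m)) (f : (Fin m → Bool) → Bool),
    Q.Computes f → ValiantCriterion.circuitSum (k := F) Q = upsetGF F f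

end

end Summit.PneNP.PneNP.Cruxes.Capture.Ideator4
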